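import Mathlib.RepresentationTheory.Basic
import Mathlib.RepresentationTheory.Invariants
import Mathlib.Algebra.Module.ZMod
import Mathlib.LinearAlgebra.Basis.Defs
import Mathlib.LinearAlgebra.TensorProduct.Basic
import Mathlib.LinearAlgebra.Matrix.Defs
import Mathlib.SetTheory.Cardinal.Finite
import HarnessLib

/-!
# Coordinates for `V ⊗_ℤ M′` over `𝔽_p`: `(Fin d → V) ≅ V ⊗ M′` along an `𝔽_p`-basis of `M′`,
# matching the matrix-twisted action with `τ ⊗ σ`

Topic `RepresentationTheory/FiniteGroups`; namespace `Literature.RepresentationTheory.FiniteGroups`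
(sub-namespace `TensorCoordinates`).  One definition with body (the coordinate isomorphism `tensorCoord`)
and theorems; no named fact, no `sorry`, no instance; Mathlib only.

Setting: a group `Δ`, a prime `p`, `τ : Representation ℤ Δ V` with `pV = 0`, an `𝔽_p = ZMod p`-module
`M′` with a `ℤ`-linear action `σ : Representation ℤ Δ M′` and an `𝔽_p`-basis `bv : Fin d → M′`, and
matrices `a : Δ → Matrix (Fin d) (Fin d) ℤ` with `σ c (bv j) = ∑ i, a c i j • bv i` (column `j` =
coordinates of `σ c (bv j)`).

* `tensorCoord τ bv : (Fin d → V) ≃ₗ[ℤ] V ⊗[ℤ] M′`, `h ↦ ∑ j, h j ⊗ bv j` (inverse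
  `v ⊗ m ↦ (i ↦ (bv.repr m i) • v)`, using the `ZMod p`-module structure on `V` given by `pV = 0`);
* **`tensorCoord_matAct`**: `tensorCoord (fun i => ∑ j, a c i j • τ c (h j)) = (τ.tprod σ) c (tensorCoord h)`;
* **`natCard_fixed_matAct_eq`**: `#{h | ∀ c, (i ↦ ∑ j, a c i j • τ c (h j)) = h} = #(V ⊗ M′)^Δ`.

Lane «TATE-EPC-TC» of cell `bsd-eis`, brick B8-alg (d) (routed by -w7 g9): the dictionary between the
"untwisted" coordinate description of `Hⁿ(U, M)` (matrices of `σ_{M′}` acting on `Fin d → Hⁿ(A)`) and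
the twisted invariant `V ↦ #(V ⊗ M′)^Δ` of `InvariantsAdditivePrimeToP`.

## References
* [SerreLinearRepresentations1977] J.-P. Serre, *Linear Representations of Finite Groups*, §1.5
  (tensor product of representations; matrix form `r_{i₁j₁}(s)·r_{i₂j₂}(s)`).
* [MilneADT2006] J. S. Milne, *Arithmetic Duality Theorems*, I §5 (proof of Thm. 5.1: `M ≈ M′ ⊗ M″`).
-/

noncomputable section

universe u v

namespace Literature.RepresentationTheory.FiniteGroups

namespace TensorCoordinates

open Function Module
open _root_.Representation _root_.LinearMap
open scoped TensorProduct

variable {Δ : Type*} [Group Δ] {p : ℕ}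
variable (V : Type u) [AddCommGroup V] {M' : Type u} [AddCommGroup M'] [Module (ZMod p) M']
variable {d : ℕ}

/-- `pV = 0` makes `V` a `ZMod p`-module (Mathlib `AddCommGroup.zmodModule`); local plumbing.
[cite: SerreLinearRepresentations1977, §15.1 (reduction mod `𝔪`)] -/
theorem nsmul_eq_zero_of_zsmul {W : Type*} [AddCommGroup W] {n : ℕ} (hW : ∀ v : W, (n : ℤ) • v = 0)
    (v : W) : n • v = 0 := by
  rw [← natCast_zsmul]; exact hW v

/-- A `ZMod p`-scalar acts through any integer lift: `c • x = (c.cast : ℤ) • x`. [folklore] -/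
private theorem zmod_smul_eq_cast_zsmul {X : Type*} [AddCommGroup X] [Module (ZMod p) X] (c : ZMod p)
    (x : X) : c • x = ((ZMod.cast c : ℤ)) • x := by
  rw [← Int.cast_smul_eq_zsmul (ZMod p), ZMod.intCast_zmod_cast]

/-- The forward coordinate map `h ↦ ∑ j, h j ⊗ bv j`. [cite: SerreLinearRepresentations1977, §1.5] -/
def coordToTensor (bv : Fin d → M') : (Fin d → V) →ₗ[ℤ] V ⊗[ℤ] M' :=
  ∑ j, (TensorProduct.mk ℤ V M').flip (bv j) ∘ₗ LinearMap.proj j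

omit [Module (ZMod p) M'] in
/-- `coordToTensor h = ∑ j, h j ⊗ bv j`. [cite: SerreLinearRepresentations1977, §1.5] -/
@[simp] theorem coordToTensor_apply (bv : Fin d → M') (h : Fin d → V) :
    coordToTensor V bv h = ∑ j, h j ⊗ₜ[ℤ] bv j := by
  simp [coordToTensor]

/-- **The coordinate isomorphism `(Fin d → V) ≃ V ⊗_ℤ M′`** along an `𝔽_p`-basis `bv` of `M′`, for
`V` killed by `p`: `h ↦ ∑ j, h j ⊗ bv j`, inverse `v ⊗ m ↦ (i ↦ (bv.repr m i) • v)`.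
[cite: SerreLinearRepresentations1977, §1.5] [cite: MilneADT2006, I §5 (proof of Thm. 5.1)] -/
def tensorCoord {V : Type u} [AddCommGroup V] (hV : ∀ v : V, (p : ℤ) • v = 0)
    (bv : Basis (Fin d) (ZMod p) M') : (Fin d → V) ≃ₗ[ℤ] V ⊗[ℤ] M' := by
  letI : Module (ZMod p) V := AddCommGroup.zmodModule (nsmul_eq_zero_of_zsmul hV)
  -- the inverse, as a `ℤ`-bilinear map
  let B : V →ₗ[ℤ] M' →ₗ[ℤ] (Fin d → V) :=
    LinearMap.mk₂ ℤ (fun v m => fun i => (bv.repr m i) • v)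
      (fun v v' m => by ext i; simp only [Pi.add_apply, smul_add])
      (fun k v m => by
        ext i
        simp only [Pi.smul_apply]
        rw [zmod_smul_eq_cast_zsmul, zmod_smul_eq_cast_zsmul, smul_comm])
      (fun v m m' => by ext i; simp only [Pi.add_apply, map_add, Finsupp.add_apply, add_smul])
      (fun k v m => by
        ext i
        simp only [Pi.smul_apply]
        rw [← Int.cast_smul_eq_zsmul (ZMod p) k m, map_smul, Finsupp.smul_apply, smul_eq_mul,
          mul_smul, Int.cast_smul_eq_zsmul])
  refine LinearEquiv.ofLinear (coordToTensor V bv) (TensorProduct.lift B) ?_ ?_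
  · -- `Φ ∘ Ψ = id`
    refine TensorProduct.ext' fun v m => ?_
    rw [LinearMap.comp_apply, TensorProduct.lift.tmul, LinearMap.id_apply, coordToTensor_apply]
    change ∑ j, ((bv.repr m j) • v) ⊗ₜ[ℤ] bv j = v ⊗ₜ[ℤ] m
    conv_rhs => rw [← bv.sum_repr m]
    rw [TensorProduct.tmul_sum]
    refine Finset.sum_congr rfl fun j _ => ?_
    rw [zmod_smul_eq_cast_zsmul, zmod_smul_eq_cast_zsmul, TensorProduct.smul_tmul]
  · -- `Ψ ∘ Φ = id`
    refine LinearMap.ext fun h => ?_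
    rw [LinearMap.comp_apply, LinearMap.id_apply, coordToTensor_apply, map_sum]
    funext i
    simp only [TensorProduct.lift.tmul, Finset.sum_apply]
    change ∑ j, (bv.repr (bv j) i) • h j = h i
    simp only [bv.repr_self, Finsupp.single_apply]
    rw [Finset.sum_eq_single i (fun j _ hji => by rw [if_neg hji, zero_smul]) (by simp)]
    rw [if_pos rfl, one_smul]

/-- `tensorCoord h = ∑ j, h j ⊗ bv j`. [cite: SerreLinearRepresentations1977, §1.5] -/
theorem tensorCoord_apply {V : Type u} [AddCommGroup V] (hV : ∀ v : V, (p : ℤ) • v = 0)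
    (bv : Basis (Fin d) (ZMod p) M') (h : Fin d → V) : tensorCoord hV bv h = ∑ j, h j ⊗ₜ[ℤ] bv j :=
  coordToTensor_apply V bv h

/-- **The matrix-twisted coordinate action is `τ ⊗ σ`**: if `σ c (bv j) = ∑ i, a c i j • bv i`, then
`tensorCoord (i ↦ ∑ j, a c i j • τ c (h j)) = (τ.tprod σ) c (tensorCoord h)`.
[cite: SerreLinearRepresentations1977, §1.5 (matrix of a tensor product)] -/
theorem tensorCoord_matAct {V : Type u} [AddCommGroup V] (hV : ∀ v : V, (p : ℤ) • v = 0)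
    (bv : Basis (Fin d) (ZMod p) M')
    (τ : Representation ℤ Δ V) (σ : Representation ℤ Δ M') (a : Δ → Matrix (Fin d) (Fin d) ℤ)
    (hσ : ∀ c j, σ c (bv j) = ∑ i, a c i j • bv i) (c : Δ) (h : Fin d → V) :
    tensorCoord hV bv (fun i => ∑ j, a c i j • τ c (h j)) = (τ.tprod σ) c (tensorCoord hV bv h) := by
  rw [tensorCoord_apply, tensorCoord_apply, map_sum]
  simp_rw [Representation.tprod_apply, TensorProduct.map_tmul, hσ, TensorProduct.tmul_sum,
    TensorProduct.sum_tmul, ← TensorProduct.smul_tmul]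
  exact Finset.sum_comm

/-- **`#{h | A(c) h = h ∀ c} = #(V ⊗ M′)^Δ`**: the fixed vectors of the matrix-twisted coordinate action
are the invariants of `τ ⊗ σ`. [cite: MilneADT2006, I §5 (proof of Thm. 5.1)] -/
theorem natCard_fixed_matAct_eq {V : Type u} [AddCommGroup V] (hV : ∀ v : V, (p : ℤ) • v = 0)
    (bv : Basis (Fin d) (ZMod p) M')
    (τ : Representation ℤ Δ V) (σ : Representation ℤ Δ M') (a : Δ → Matrix (Fin d) (Fin d) ℤ)
    (hσ : ∀ c j, σ c (bv j) = ∑ i, a c i j • bv i) :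
    Nat.card {h : Fin d → V // ∀ c, (fun i => ∑ j, a c i j • τ c (h j)) = h} =
      Nat.card (Representation.invariants (τ.tprod σ)) := by
  refine Nat.card_congr ((tensorCoord hV bv).toEquiv.subtypeEquiv fun h => ?_)
  change (∀ c, (fun i => ∑ j, a c i j • τ c (h j)) = h) ↔
    tensorCoord hV bv h ∈ Representation.invariants (τ.tprod σ)
  rw [Representation.mem_invariants]
  refine forall_congr' fun c => ?_
  rw [← tensorCoord_matAct hV bv τ σ a hσ c h]
  exact ⟨fun hh => by rw [hh], fun hh => (tensorCoord hV bv).injective hh⟩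

end TensorCoordinates

end Literature.RepresentationTheory.FiniteGroups

end
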